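import Summits.Ventures.PercRepro.GenQSevenFiveTypeTwo
import Summits.Ventures.PercRepro.GenQOpenLayersCore

/-!
# PercRepro — the `(7, 5)` layers on the core are their `t = 3, 4` clauses (night-4, gen 3)

With the type-`2` window of level `5` in the kernel (`jq_two_nonneg_of_core_five`, `GenQSevenFiveTypeTwo.lean`),
`SevenFiveLayersCore` — and with it `OpenLayersCore 5`, C-025 and C-029 at `(7, 5)` — follow from the type-`3` and
type-`4` balances on the rank-`5` flats of rank-`7` Core matroids alone (`SevenFiveHighLayersCore`).
-/

namespace PercRepro.GenQ

open Finset ThmH PerFlat SixFour ThmN NightThree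

/-- **The high layers of `(7, 5)` on the core**: the type-`3` and type-`4` balances on every rank-`5` flat of a
rank-`7` Core matroid — the exact remaining gap of the row `(7, 5)` after the type-`2` window. -/
def SevenFiveHighLayersCore : Prop :=
  ∀ {β : Type} [DecidableEq β] (M : Matroid β) [M.Finite] (G : Finset β), Core M 7 → G ∈ flatsQ M 5 →
    0 ≤ Jq M G 5 3 ∧ 0 ≤ Jq M G 5 4

/-- `SevenFiveLayersCore` from the high layers: the type-`2` window is the kernel theorem
`jq_two_nonneg_of_core_five`. -/
theorem sevenFiveLayersCore_of_high (h : SevenFiveHighLayersCore) : SevenFiveLayersCore := by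
  intro β _ M _ G hc hG _
  exact ⟨fun hcard => jq_two_nonneg_of_core_five hc hG hcard, (h M G hc hG).1, (h M G hc hG).2⟩

/-- `OpenLayersCore 5` from the high layers of `(7, 5)`. -/
theorem openLayersCore_five_of_high (h : SevenFiveHighLayersCore) : OpenLayersCore 5 :=
  openLayersCore_five_of_sevenFiveLayersCore (sevenFiveLayersCore_of_high h)

/-- **C-025 at `(7, 5)` on every finite matroid from the type-`3` and type-`4` balances on the core.** -/
theorem rls_seven_five_of_high {α : Type} [DecidableEq α] (h : SevenFiveHighLayersCore) (M : Matroid α)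
    [M.Finite] : RLS M 7 5 :=
  rls_seven_five_of_layersCore (sevenFiveLayersCore_of_high h) M

/-- **C-029 at `(7, 5)` on the core from the type-`3` and type-`4` balances.** -/
theorem hall_seven_five_core_of_high {γ : Type} [DecidableEq γ] {M : Matroid γ} [M.Finite]
    (h : SevenFiveHighLayersCore) (hc : Core M 7) : Hall M 7 5 (phiK 7 5) :=
  hall_seven_five_core_of_layersCore (sevenFiveLayersCore_of_high h) hc

end PercRepro.GenQ
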